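/-
Copyright (c) 2026 the pub-hodgecm-mathlib formalisation cell (harness21).  Prover seat hodgecm-mathlib-K2E2-p05 (g0),
Track B «K2-LIT» ∕ h413 (stmt-HodgeConjecture-24833), line K2_E2 «ThetaExhaustionByRigidity», unit «CLASS-TRANSPORT», file #5:
payment of the socket `K2E2ThetaExhaustionByRigidity.ClassTransport.sig_K2E2TrBijectiveOfInjective` — AN INJECTIVE INTERTWINER
FROM A NON-ZERO REPRESENTATION INTO AN IRREDUCIBLE ONE IS BIJECTIVE.  2026-09-03.
-/
import Mathlib.RepresentationTheory.Irreducible   -- `Representation.IsIrreducible`, `IntertwiningMap.equivLinearMapAsModule`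
import Mathlib.RingTheory.SimpleModule.Basic       -- `LinearMap.surjective_or_eq_zero`
import Mathlib.Data.Complex.Basic                  -- `ℂ`
import HarnessLib

/-!
# K2_E2 road (h413 = stmt-HodgeConjecture-24833), unit «CLASS-TRANSPORT», file #5 (TR-1):
# an injective intertwiner from a non-zero representation into an irreducible one is bijective

Cell `pub/hodgecm-mathlib` (D-0151), Track B (21-frontier RULING «PUSH BOTH» 2026-09-03, director req621∕req624, chair K2-lead,
dealer K2E2-plan), socket module
`Summits/HodgeConjecture/HodgeConjecture/Cruxes/H413/Lines/K2_E2_ThetaExhaustionByRigidity_ClassTransport.lean` (planner K2E2-plan (g0),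
sha16 c1718b627d06a747), socket **`sig_K2E2TrBijectiveOfInjective`** (TABLE row #5, size S, first rung, Mathlib side): for complex
representations `σ` on `V` and `ρ` on `W` of a group `G`, with `ρ` IRREDUCIBLE and `V` NON-TRIVIAL, every INJECTIVE intertwiner
`f : σ → ρ` is BIJECTIVE.  It is the Schur-free half of the closer `sig_K2E2TrFinComponentTransport` (TR-4 = tier-0
`StubFinComponentTransport`): an irreducible finite component `σ` of `P` embedded in the irreducible carrier `ω_H(μ, a, χ)`
(★ `F0P2cStubCI.rhoAtLine_chi_isIrreducible`) IS that carrier up to an equivariant bijection.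

THE MATHEMATICS (Mathlib `Representation.IsIrreducible ρ := IsSimpleOrder (Subrepresentation ρ)`, which EXCLUDES the zero
representation).  An intertwiner `f : σ → ρ` is the same thing as a `ℂ[G]`-linear map `σ.asModule → ρ.asModule`
(Mathlib `IntertwiningMap.equivLinearMapAsModule`, whose underlying function is `⇑f`), and `ρ.asModule` is a SIMPLE `ℂ[G]`-module when
`ρ` is irreducible (Mathlib instance `Representation.IsIrreducible.instIsSimpleModule…`); a linear map INTO a simple module is surjective or
zero (Mathlib `LinearMap.surjective_or_eq_zero`: its range is a submodule of a simple module).  An injective map out of a non-trivial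
module is not zero (it separates `0` from a second vector), so `f` is surjective, hence bijective.  Compare Mathlib's
`Representation.IsIrreducible.bijective_or_eq_zero`, which needs BOTH sides irreducible; here only the target is, and injectivity of `f`
replaces irreducibility of the source.
* §1 `ne_zero_of_injective` — an injective intertwiner out of a non-trivial space is non-zero;
  `surjective_of_ne_zero` — a non-zero intertwiner INTO an irreducible representation is surjective (any field, any monoid).
* §2 **`trBijectiveOfInjective`** — `sig_K2E2TrBijectiveOfInjective` TOKEN FOR TOKEN.
No hypothesis is idle: without `ρ.IsIrreducible` take `f = ` the inclusion of a proper non-zero subrepresentation; without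
`Nontrivial V` the zero map `0 → ρ` is injective and not surjective (`ρ ≠ 0` by irreducibility).

HONEST LABEL: HC_CM is proved only modulo the 7 printed citations (2 remaining named inputs: hLiu418 = stmt-HodgeConjecture-24832,
h413 = stmt-HodgeConjecture-24833) until rung 0 closes; this file is a `--supports stmt-HodgeConjecture-24833` helper (first rung of
the K2_E2 road, consumed BY NAME by the closer #8 `K2E2TrFinComponentTransport`) and retires nothing by itself.

## References
* [Liu2021] Y. Liu, *Theta correspondence for almost unramified representations of unitary groups*, J. Number Theory 230 (2022),
  App. D Lem. D.1 (1) (irreducibility of `ω(μ, ε, χ)`).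
* [BorelJacquet1979] A. Borel, H. Jacquet, *Automorphic forms and automorphic representations*, Proc. Sympos. Pure Math. 33.1
  (1979), §4.6.
-/

set_option autoImplicit false
-- the mandated namespace repeats the single-problem summit's segment (`HodgeConjecture.HodgeConjecture`)
set_option linter.dupNamespace false

namespace Summit.HodgeConjecture.HodgeConjecture.Cruxes.H413.K2E2TrBijectiveOfInjective

open Representation

/-! ## §1  Non-zero intertwiners into an irreducible representation are surjective -/

/-- An INJECTIVE intertwiner out of a NON-TRIVIAL space is not the zero intertwiner: it separates `0` from a second vector of `V`,
while the zero map does not. [folklore] -/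
theorem ne_zero_of_injective {k G V W : Type*} [Semiring k] [Monoid G] [AddCommMonoid V] [Module k V] [AddCommMonoid W]
    [Module k W] {σ : Representation k G V} {ρ : Representation k G W} [Nontrivial V] (f : σ.IntertwiningMap ρ)
    (hf : Function.Injective f) : f ≠ 0 := by
  intro h
  obtain ⟨v, hv⟩ := exists_ne (0 : V)
  exact hv (hf (by rw [h, IntertwiningMap.coe_zero, Pi.zero_apply, Pi.zero_apply]))

/-- A NON-ZERO intertwiner INTO an IRREDUCIBLE representation is surjective (any field `k`, any monoid `G`): read `f` as a
`k[G]`-linear map `σ.asModule → ρ.asModule` (Mathlib `IntertwiningMap.equivLinearMapAsModule`, same underlying function); the target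
is a simple `k[G]`-module (`ρ` irreducible), and a linear map into a simple module is surjective or zero (Mathlib
`LinearMap.surjective_or_eq_zero`). [cite: BorelJacquet1979, §4.6] -/
theorem surjective_of_ne_zero {k G V W : Type*} [Field k] [Monoid G] [AddCommGroup V] [Module k V] [AddCommGroup W] [Module k W]
    {σ : Representation k G V} {ρ : Representation k G W} [ρ.IsIrreducible] (f : σ.IntertwiningMap ρ) (hf : f ≠ 0) :
    Function.Surjective f := by
  rcases LinearMap.surjective_or_eq_zero (IntertwiningMap.equivLinearMapAsModule σ ρ f) with h | h
  · exact h
  · exact absurd ((LinearEquiv.map_eq_zero_iff _).mp h) hf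

/-! ## §2  The head -/

/-- **PAYMENT OF `sig_K2E2TrBijectiveOfInjective`** (socket #5 = TR-1 of unit «CLASS-TRANSPORT» of the K2_E2 road,
`Cruxes/H413/Lines/K2_E2_ThetaExhaustionByRigidity_ClassTransport.lean`, TOKEN FOR TOKEN).
**An injective intertwiner from a non-zero representation INTO an irreducible one is bijective.**  The range of `f` is a
subrepresentation of the irreducible `ρ`, non-zero because `V` is non-trivial and `f` injective (§1 `ne_zero_of_injective`), hence all
of `W` (§1 `surjective_of_ne_zero`: Mathlib `Representation.IsIrreducible` = `IsSimpleOrder (Subrepresentation ρ)`, read through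
`ρ.asModule` simple over `ℂ[G]`); compare Mathlib `Representation.IsIrreducible.bijective_or_eq_zero`, which needs BOTH sides irreducible.
[cite: Liu2021, App. D Lem. D.1 (1)] [cite: BorelJacquet1979, §4.6] -/
theorem trBijectiveOfInjective :
    ∀ {G : Type} [Group G] {V W : Type} [AddCommGroup V] [Module ℂ V] [AddCommGroup W] [Module ℂ W]
      (σ : Representation ℂ G V) (ρ : Representation ℂ G W),
      ρ.IsIrreducible → Nontrivial V → ∀ f : σ.IntertwiningMap ρ, Function.Injective f → Function.Bijective f := by
  intro G _ V W _ _ _ _ σ ρ hρ hV f hf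
  exact ⟨hf, surjective_of_ne_zero f (ne_zero_of_injective f hf)⟩

end Summit.HodgeConjecture.HodgeConjecture.Cruxes.H413.K2E2TrBijectiveOfInjective
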